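import Literature.NumberTheory.Transcendental.DrinfeldAssociatorRegularisation
import Literature.NumberTheory.Transcendental.Associators
import HarnessLib

/-!
# `PentagonInKZ`, line `edge-normal-newton-leibniz`: corner engine — facts about the concrete dictionary

Towards the instantiation of the abstract corner engine (`engine_main`) at the concrete dictionary
of the crux `FurushoPentagon.PentagonInKZ` (stub `cornerEngine_uniformlyNull`,
stmt-KontsevichZagierPeriods-11348): edge values of the `regEnd`-regularised word integrands
(`regEnd x [] [] = 1`; words ending in the regularised letter have coefficient `0`, whence
`Ht U x 0 η = 0`, `Vt V y ξ 0 = 0` for non-empty words), their calculus (derivatives, Euler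
derivatives, continuity) and bounds from those of the word integrands, all as finite
`ℚ`-combinations.  Dictionaries are hypothesised (no definitions).

References: K. Ihara, M. Kaneko, D. Zagier, Compos. Math. 142 (2006), Cor. 5.
-/

noncomputable section

open Set
open Literature.NumberTheory.Transcendental

namespace Summit.KontsevichZagierPeriods.FurushoPentagon.PentagonInKZ

/-! ## Instantiation: the registered engine theorem from the abstract engine

Facts about the CONCRETE dictionary of the crux (letters `0`, `1`; `regEnd`-regularised word
integrands) needed to discharge the hypothesis bundle, then `cornerEngine_uniformlyNull`. -/

section InstAux

variable {m : ℕ}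

/-- `regEnd x [] = δ_{[]}`, so its value at the empty word is `1`. [cite: IharaKanekoZagier2006, Cor. 5] -/
theorem regEnd_nil_nil (x : Fin (m + 2)) : Shuffle.regEnd x ([] : List (Fin (m + 2))) [] = 1 := by
  simp [Shuffle.regEnd, Shuffle.regFront, Shuffle.leadCount, Shuffle.shuffleSum, Shuffle.wordSum]

/-- A word of positive length ending in the regularised letter has coefficient `0` in every
`regEnd x W`. [cite: IharaKanekoZagier2006, Cor. 5] -/
theorem regEnd_ofFn_last (x : Fin (m + 2)) (W : List (Fin (m + 2))) {k : ℕ} (u : Fin (k + 1) → Fin (m + 2))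
    (hu : u (Fin.last k) = x) : Shuffle.regEnd x W (List.ofFn u) = 0 := by
  by_contra h
  have hmem : List.ofFn u ∈ (Shuffle.regEnd x W).support := Finsupp.mem_support_iff.2 h
  have hne := Shuffle.getLast?_ne_of_mem_support_regEnd x W hmem
  apply hne
  rw [List.ofFn_succ', List.concat_eq_append, List.getLast?_append, List.getLast?_singleton, hu]
  rfl

variable {cf : Fin (m + 2) → Fin 4 → ℚ} {fd gd : Fin (m + 2) → ℝ → ℝ → ℝ}
  {qH qV dqH dqV : ∀ {n : ℕ}, (Fin n → Fin (m + 2)) → (Fin n → ℝ) → ℝ → ℝ → ℝ}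
  (hqH : ∀ {n : ℕ} (u : Fin n → Fin (m + 2)) (x : Fin n → ℝ) (ξ η : ℝ), qH u x ξ η =
    ∏ i, if u i = 0 then 1 / x i else (ξ * ∏ j ∈ Finset.univ.filter (fun j => j < i), x j) *
      fd (u i) (ξ * ∏ j ∈ Finset.univ.filter (fun j => j ≤ i), x j) η)
  (hqV : ∀ {n : ℕ} (v : Fin n → Fin (m + 2)) (y : Fin n → ℝ) (ξ η : ℝ), qV v y ξ η =
    ∏ i, if v i = 1 then 1 / y i else (η * ∏ j ∈ Finset.univ.filter (fun j => j < i), y j) *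
      gd (v i) ξ (η * ∏ j ∈ Finset.univ.filter (fun j => j ≤ i), y j))
  (hdqH : ∀ {n : ℕ} (u : Fin n → Fin (m + 2)) (x : Fin n → ℝ) (ξ η : ℝ), dqH u x ξ η =
    ∑ j, (if u j = 0 then 0 else
      (∏ j' ∈ Finset.univ.filter (fun j' => j' < j), x j') *
          fd (u j) (ξ * ∏ j' ∈ Finset.univ.filter (fun j' => j' ≤ j), x j') η -
        (ξ * ∏ j' ∈ Finset.univ.filter (fun j' => j' < j), x j') *
          (∏ j' ∈ Finset.univ.filter (fun j' => j' ≤ j), x j') *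
          (fd (u j) (ξ * ∏ j' ∈ Finset.univ.filter (fun j' => j' ≤ j), x j') η) ^ 2) *
      ∏ i ∈ Finset.univ.erase j, if u i = 0 then 1 / x i else
        (ξ * ∏ j' ∈ Finset.univ.filter (fun j' => j' < i), x j') *
          fd (u i) (ξ * ∏ j' ∈ Finset.univ.filter (fun j' => j' ≤ i), x j') η)
  (hdqV : ∀ {n : ℕ} (v : Fin n → Fin (m + 2)) (y : Fin n → ℝ) (ξ η : ℝ), dqV v y ξ η =
    ∑ j, (if v j = 1 then 0 else
      (∏ j' ∈ Finset.univ.filter (fun j' => j' < j), y j') *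
          gd (v j) ξ (η * ∏ j' ∈ Finset.univ.filter (fun j' => j' ≤ j), y j') -
        (η * ∏ j' ∈ Finset.univ.filter (fun j' => j' < j), y j') *
          (∏ j' ∈ Finset.univ.filter (fun j' => j' ≤ j), y j') *
          (gd (v j) ξ (η * ∏ j' ∈ Finset.univ.filter (fun j' => j' ≤ j), y j')) ^ 2) *
      ∏ i ∈ Finset.univ.erase j, if v i = 1 then 1 / y i else
        (η * ∏ j' ∈ Finset.univ.filter (fun j' => j' < i), y j') *
          gd (v i) ξ (η * ∏ j' ∈ Finset.univ.filter (fun j' => j' ≤ i), y j'))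
  {Ht Vt dHt dVt : ∀ {n : ℕ}, (Fin n → Fin (m + 2)) → (Fin n → ℝ) → ℝ → ℝ → ℝ}
  (hHt : ∀ {n : ℕ} (U : Fin n → Fin (m + 2)) (x : Fin n → ℝ) (ξ η : ℝ), Ht U x ξ η =
    ∑ u : Fin n → Fin (m + 2), (Shuffle.regEnd (0 : Fin (m + 2)) (List.ofFn U) (List.ofFn u) : ℝ) * qH u x ξ η)
  (hVt : ∀ {n : ℕ} (V : Fin n → Fin (m + 2)) (y : Fin n → ℝ) (ξ η : ℝ), Vt V y ξ η =
    ∑ v : Fin n → Fin (m + 2), (Shuffle.regEnd (1 : Fin (m + 2)) (List.ofFn V) (List.ofFn v) : ℝ) * qV v y ξ η)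
  (hdHt : ∀ {n : ℕ} (U : Fin n → Fin (m + 2)) (x : Fin n → ℝ) (ξ η : ℝ), dHt U x ξ η =
    ∑ u : Fin n → Fin (m + 2), (Shuffle.regEnd (0 : Fin (m + 2)) (List.ofFn U) (List.ofFn u) : ℝ) * dqH u x ξ η)
  (hdVt : ∀ {n : ℕ} (V : Fin n → Fin (m + 2)) (y : Fin n → ℝ) (ξ η : ℝ), dVt V y ξ η =
    ∑ v : Fin n → Fin (m + 2), (Shuffle.regEnd (1 : Fin (m + 2)) (List.ofFn V) (List.ofFn v) : ℝ) * dqV v y ξ η)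

include hqH hHt in
/-- The regularised horizontal integrand of the empty word is `1`. [folklore] -/
theorem inst_Ht_nil (U : Fin 0 → Fin (m + 2)) (x : Fin 0 → ℝ) (ξ η : ℝ) : Ht U x ξ η = 1 := by
  rw [hHt, Fintype.sum_unique, hqH]
  simp [regEnd_nil_nil]

include hqV hVt in
/-- The regularised vertical integrand of the empty word is `1`. [folklore] -/
theorem inst_Vt_nil (V : Fin 0 → Fin (m + 2)) (y : Fin 0 → ℝ) (ξ η : ℝ) : Vt V y ξ η = 1 := by
  rw [hVt, Fintype.sum_unique, hqV]
  simp [regEnd_nil_nil]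

include hdqH hdHt in
/-- The derivative of the regularised horizontal integrand of the empty word is `0`. [folklore] -/
theorem inst_dHt_nil (U : Fin 0 → Fin (m + 2)) (x : Fin 0 → ℝ) (ξ η : ℝ) : dHt U x ξ η = 0 := by
  rw [hdHt, Fintype.sum_unique, hdqH]
  simp

include hdqV hdVt in
/-- The derivative of the regularised vertical integrand of the empty word is `0`. [folklore] -/
theorem inst_dVt_nil (V : Fin 0 → Fin (m + 2)) (y : Fin 0 → ℝ) (ξ η : ℝ) : dVt V y ξ η = 0 := by
  rw [hdVt, Fintype.sum_unique, hdqV]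
  simp

include hqH hHt in
/-- **The horizontal transport starts at the identity**: `Ht U x 0 η = 0` for non-empty `U`
(words with a letter `≠ 0` carry a factor `ξ = 0`; the word `0…0` ends in `0` and has coefficient
`0` in `regEnd 0`). [cite: IharaKanekoZagier2006, Cor. 5] -/
theorem inst_Ht_zero {k : ℕ} (U : Fin (k + 1) → Fin (m + 2)) (x : Fin (k + 1) → ℝ) (η : ℝ) : Ht U x 0 η = 0 := by
  rw [hHt]
  refine Finset.sum_eq_zero fun u _ => ?_
  by_cases hu : ∃ i, u i ≠ 0
  · obtain ⟨i, hi⟩ := hu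
    rw [hqH, Finset.prod_eq_zero (Finset.mem_univ i) (by rw [if_neg hi]; simp), mul_zero]
  · push Not at hu
    rw [regEnd_ofFn_last 0 _ u (hu _), Rat.cast_zero, zero_mul]

include hqV hVt in
/-- **The vertical transport starts at the identity**: `Vt V y ξ 0 = 0` for non-empty `V`.
[cite: IharaKanekoZagier2006, Cor. 5] -/
theorem inst_Vt_zero {l : ℕ} (V : Fin (l + 1) → Fin (m + 2)) (y : Fin (l + 1) → ℝ) (ξ : ℝ) : Vt V y ξ 0 = 0 := by
  rw [hVt]
  refine Finset.sum_eq_zero fun v _ => ?_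
  by_cases hv : ∃ i, v i ≠ 1
  · obtain ⟨i, hi⟩ := hv
    rw [hqV, Finset.prod_eq_zero (Finset.mem_univ i) (by rw [if_neg hi]; simp), mul_zero]
  · push Not at hv
    rw [regEnd_ofFn_last 1 _ v (hv _), Rat.cast_zero, zero_mul]

/-! ### Calculus of the regularised integrands from that of the word integrands -/

include hHt hdHt in
/-- `HasDerivAt` of `Ht` in the first dilation, from that of the `qH u`. [folklore] -/
theorem inst_Ht_deriv {α β : ℚ}
    (hq : ∀ {n : ℕ} (u : Fin n → Fin (m + 2)) (x : Fin n → ℝ) (ξ η : ℝ), (∀ i, 0 ≤ x i ∧ x i ≤ 1) →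
      0 ≤ ξ → ξ ≤ (α : ℝ) → 0 ≤ η → η ≤ (β : ℝ) → HasDerivAt (fun s => qH u x s η) (dqH u x ξ η) ξ)
    {k : ℕ} (U : Fin k → Fin (m + 2)) (x : Fin k → ℝ) (ξ η : ℝ) (hx : ∀ i, 0 ≤ x i ∧ x i ≤ 1)
    (hξ : 0 ≤ ξ) (hξα : ξ ≤ (α : ℝ)) (hη : 0 ≤ η) (hηβ : η ≤ (β : ℝ)) :
    HasDerivAt (fun t => Ht U x t η) (dHt U x ξ η) ξ := by
  have h1 : (fun t => Ht U x t η) = fun t => ∑ u : Fin k → Fin (m + 2),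
      (Shuffle.regEnd (0 : Fin (m + 2)) (List.ofFn U) (List.ofFn u) : ℝ) * qH u x t η := funext fun t => hHt U x t η
  rw [h1, hdHt]
  exact HasDerivAt.fun_sum fun u _ => (hq u x ξ η hx hξ hξα hη hηβ).const_mul _

include hVt hdVt in
/-- `HasDerivAt` of `Vt` in the second dilation, from that of the `qV v`. [folklore] -/
theorem inst_Vt_deriv {α β : ℚ}
    (hq : ∀ {n : ℕ} (v : Fin n → Fin (m + 2)) (y : Fin n → ℝ) (ξ η : ℝ), (∀ i, 0 ≤ y i ∧ y i ≤ 1) →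
      0 ≤ ξ → ξ ≤ (α : ℝ) → 0 ≤ η → η ≤ (β : ℝ) → HasDerivAt (fun s => qV v y ξ s) (dqV v y ξ η) η)
    {l : ℕ} (V : Fin l → Fin (m + 2)) (y : Fin l → ℝ) (ξ η : ℝ) (hy : ∀ i, 0 ≤ y i ∧ y i ≤ 1)
    (hξ : 0 ≤ ξ) (hξα : ξ ≤ (α : ℝ)) (hη : 0 ≤ η) (hηβ : η ≤ (β : ℝ)) :
    HasDerivAt (fun s => Vt V y ξ s) (dVt V y ξ η) η := by
  have h1 : (fun s => Vt V y ξ s) = fun s => ∑ v : Fin l → Fin (m + 2),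
      (Shuffle.regEnd (1 : Fin (m + 2)) (List.ofFn V) (List.ofFn v) : ℝ) * qV v y ξ s := funext fun s => hVt V y ξ s
  rw [h1, hdVt]
  exact HasDerivAt.fun_sum fun v _ => (hq v y ξ η hy hξ hξα hη hηβ).const_mul _

include hHt hdHt in
/-- The Euler derivative `∂ₜ (t · Ht U (t :: x') ξ η)` from that of the `qH u`. [folklore] -/
theorem inst_Ht_euler {α β : ℚ}
    (hq : ∀ {n : ℕ} (u : Fin (n + 1) → Fin (m + 2)) (x₀ : ℝ) (x' : Fin n → ℝ) (ξ η : ℝ), 0 < x₀ → x₀ < 1 →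
      (∀ i, 0 ≤ x' i ∧ x' i ≤ 1) → 0 ≤ ξ → ξ ≤ (α : ℝ) → 0 ≤ η → η ≤ (β : ℝ) →
      HasDerivAt (fun t => t * qH u (Fin.cons t x') ξ η) (ξ * dqH u (Fin.cons x₀ x') ξ η) x₀)
    {k : ℕ} (U : Fin (k + 1) → Fin (m + 2)) (x₀ : ℝ) (x' : Fin k → ℝ) (ξ η : ℝ) (h₀ : 0 < x₀) (h₁ : x₀ < 1)
    (hx : ∀ i, 0 ≤ x' i ∧ x' i ≤ 1) (hξ : 0 ≤ ξ) (hξα : ξ ≤ (α : ℝ)) (hη : 0 ≤ η) (hηβ : η ≤ (β : ℝ)) :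
    HasDerivAt (fun t => t * Ht U (Fin.cons t x') ξ η) (ξ * dHt U (Fin.cons x₀ x') ξ η) x₀ := by
  have h1 : (fun t => t * Ht U (Fin.cons t x') ξ η) = fun t => ∑ u : Fin (k + 1) → Fin (m + 2),
      (Shuffle.regEnd (0 : Fin (m + 2)) (List.ofFn U) (List.ofFn u) : ℝ) * (t * qH u (Fin.cons t x') ξ η) := by
    funext t; rw [hHt, Finset.mul_sum]; exact Finset.sum_congr rfl fun u _ => by ring
  have h2 : ξ * dHt U (Fin.cons x₀ x') ξ η = ∑ u : Fin (k + 1) → Fin (m + 2),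
      (Shuffle.regEnd (0 : Fin (m + 2)) (List.ofFn U) (List.ofFn u) : ℝ) * (ξ * dqH u (Fin.cons x₀ x') ξ η) := by
    rw [hdHt, Finset.mul_sum]; exact Finset.sum_congr rfl fun u _ => by ring
  rw [h1, h2]
  exact HasDerivAt.fun_sum fun u _ => (hq u x₀ x' ξ η h₀ h₁ hx hξ hξα hη hηβ).const_mul _

include hVt hdVt in
/-- The Euler derivative `∂ₜ (t · Vt V (t :: y') ξ η)` from that of the `qV v`. [folklore] -/
theorem inst_Vt_euler {α β : ℚ}
    (hq : ∀ {n : ℕ} (v : Fin (n + 1) → Fin (m + 2)) (y₀ : ℝ) (y' : Fin n → ℝ) (ξ η : ℝ), 0 < y₀ → y₀ < 1 →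
      (∀ i, 0 ≤ y' i ∧ y' i ≤ 1) → 0 ≤ ξ → ξ ≤ (α : ℝ) → 0 ≤ η → η ≤ (β : ℝ) →
      HasDerivAt (fun t => t * qV v (Fin.cons t y') ξ η) (η * dqV v (Fin.cons y₀ y') ξ η) y₀)
    {l : ℕ} (V : Fin (l + 1) → Fin (m + 2)) (y₀ : ℝ) (y' : Fin l → ℝ) (ξ η : ℝ) (h₀ : 0 < y₀) (h₁ : y₀ < 1)
    (hy : ∀ i, 0 ≤ y' i ∧ y' i ≤ 1) (hξ : 0 ≤ ξ) (hξα : ξ ≤ (α : ℝ)) (hη : 0 ≤ η) (hηβ : η ≤ (β : ℝ)) :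
    HasDerivAt (fun t => t * Vt V (Fin.cons t y') ξ η) (η * dVt V (Fin.cons y₀ y') ξ η) y₀ := by
  have h1 : (fun t => t * Vt V (Fin.cons t y') ξ η) = fun t => ∑ v : Fin (l + 1) → Fin (m + 2),
      (Shuffle.regEnd (1 : Fin (m + 2)) (List.ofFn V) (List.ofFn v) : ℝ) * (t * qV v (Fin.cons t y') ξ η) := by
    funext t; rw [hVt, Finset.mul_sum]; exact Finset.sum_congr rfl fun v _ => by ring
  have h2 : η * dVt V (Fin.cons y₀ y') ξ η = ∑ v : Fin (l + 1) → Fin (m + 2),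
      (Shuffle.regEnd (1 : Fin (m + 2)) (List.ofFn V) (List.ofFn v) : ℝ) * (η * dqV v (Fin.cons y₀ y') ξ η) := by
    rw [hdVt, Finset.mul_sum]; exact Finset.sum_congr rfl fun v _ => by ring
  rw [h1, h2]
  exact HasDerivAt.fun_sum fun v _ => (hq v y₀ y' ξ η h₀ h₁ hy hξ hξα hη hηβ).const_mul _

include hHt in
/-- Continuity of `t ↦ t · Ht U (t :: x') ξ η` on `[0,1]` from that of the `qH u` for words not
ending in `0` (the others have coefficient `0`). [folklore] -/
theorem inst_Ht_cont {α β : ℚ}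
    (hq : ∀ {n : ℕ} (u : Fin (n + 1) → Fin (m + 2)) (x' : Fin n → ℝ) (ξ η : ℝ), u (Fin.last n) ≠ 0 →
      (∀ i, 0 ≤ x' i ∧ x' i ≤ 1) → 0 ≤ ξ → ξ ≤ (α : ℝ) → 0 ≤ η → η ≤ (β : ℝ) →
      ContinuousOn (fun t => t * qH u (Fin.cons t x') ξ η) (Icc 0 1))
    {k : ℕ} (U : Fin (k + 1) → Fin (m + 2)) (x' : Fin k → ℝ) (ξ η : ℝ)
    (hx : ∀ i, 0 ≤ x' i ∧ x' i ≤ 1) (hξ : 0 ≤ ξ) (hξα : ξ ≤ (α : ℝ)) (hη : 0 ≤ η) (hηβ : η ≤ (β : ℝ)) :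
    ContinuousOn (fun t => t * Ht U (Fin.cons t x') ξ η) (Icc 0 1) := by
  have h1 : (fun t => t * Ht U (Fin.cons t x') ξ η) = fun t => ∑ u : Fin (k + 1) → Fin (m + 2),
      (Shuffle.regEnd (0 : Fin (m + 2)) (List.ofFn U) (List.ofFn u) : ℝ) * (t * qH u (Fin.cons t x') ξ η) := by
    funext t; rw [hHt, Finset.mul_sum]; exact Finset.sum_congr rfl fun u _ => by ring
  rw [h1]
  refine continuousOn_finsetSum _ fun u _ => ?_
  by_cases hu : u (Fin.last k) = 0
  · rw [regEnd_ofFn_last 0 _ u hu]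
    simp only [Rat.cast_zero, zero_mul]
    exact continuousOn_const
  · exact continuousOn_const.mul (hq u x' ξ η hu hx hξ hξα hη hηβ)

include hVt in
/-- Continuity of `t ↦ t · Vt V (t :: y') ξ η` on `[0,1]`. [folklore] -/
theorem inst_Vt_cont {α β : ℚ}
    (hq : ∀ {n : ℕ} (v : Fin (n + 1) → Fin (m + 2)) (y' : Fin n → ℝ) (ξ η : ℝ), v (Fin.last n) ≠ 1 →
      (∀ i, 0 ≤ y' i ∧ y' i ≤ 1) → 0 ≤ ξ → ξ ≤ (α : ℝ) → 0 ≤ η → η ≤ (β : ℝ) →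
      ContinuousOn (fun t => t * qV v (Fin.cons t y') ξ η) (Icc 0 1))
    {l : ℕ} (V : Fin (l + 1) → Fin (m + 2)) (y' : Fin l → ℝ) (ξ η : ℝ)
    (hy : ∀ i, 0 ≤ y' i ∧ y' i ≤ 1) (hξ : 0 ≤ ξ) (hξα : ξ ≤ (α : ℝ)) (hη : 0 ≤ η) (hηβ : η ≤ (β : ℝ)) :
    ContinuousOn (fun t => t * Vt V (Fin.cons t y') ξ η) (Icc 0 1) := by
  have h1 : (fun t => t * Vt V (Fin.cons t y') ξ η) = fun t => ∑ v : Fin (l + 1) → Fin (m + 2),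
      (Shuffle.regEnd (1 : Fin (m + 2)) (List.ofFn V) (List.ofFn v) : ℝ) * (t * qV v (Fin.cons t y') ξ η) := by
    funext t; rw [hVt, Finset.mul_sum]; exact Finset.sum_congr rfl fun v _ => by ring
  rw [h1]
  refine continuousOn_finsetSum _ fun v _ => ?_
  by_cases hv : v (Fin.last l) = 1
  · rw [regEnd_ofFn_last 1 _ v hv]
    simp only [Rat.cast_zero, zero_mul]
    exact continuousOn_const
  · exact continuousOn_const.mul (hq v y' ξ η hv hy hξ hξα hη hηβ)

/-! ### Bounds of the regularised integrands from those of the word integrands -/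

/-- **Regularised bounds from word bounds** (generic in the letter `x`, the word integrands `q`,
`dq` and the roles `r ∈ [0, A]`, `p ∈ [0, B]` of the two dilations): finite `ℚ`-combinations with
the `regEnd x` coefficients inherit boundedness, the vanishing order in `r` and the transverse
Lipschitz bound, uniformly in the words of a given length. [folklore] -/
theorem reg_bounds (x : Fin (m + 2)) (A B : ℝ)
    (q dq T dT : ∀ {n : ℕ}, (Fin n → Fin (m + 2)) → (Fin n → ℝ) → ℝ → ℝ → ℝ)
    (hT : ∀ {n : ℕ} (U : Fin n → Fin (m + 2)) (z : Fin n → ℝ) (r p : ℝ), T U z r p =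
      ∑ u : Fin n → Fin (m + 2), (Shuffle.regEnd x (List.ofFn U) (List.ofFn u) : ℝ) * q u z r p)
    (hdT : ∀ {n : ℕ} (U : Fin n → Fin (m + 2)) (z : Fin n → ℝ) (r p : ℝ), dT U z r p =
      ∑ u : Fin n → Fin (m + 2), (Shuffle.regEnd x (List.ofFn U) (List.ofFn u) : ℝ) * dq u z r p)
    (hbd : ∀ n : ℕ, ∃ C : ℝ, ∀ (u : Fin n → Fin (m + 2)) (z : Fin n → ℝ) (r p : ℝ),
      (List.ofFn u).getLast? ≠ some x → (∀ i, 0 ≤ z i ∧ z i ≤ 1) → 0 ≤ r → r ≤ A → 0 ≤ p → p ≤ B →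
      |q u z r p| ≤ C ∧ |dq u z r p| ≤ C ∧ (0 < n → |q u z r p| ≤ C * r) ∧
      (∀ p' : ℝ, 0 ≤ p' → p' ≤ B → |q u z r p - q u z r p'| ≤ C * r * |p - p'|)) :
    ∀ n : ℕ, ∃ C : ℝ, ∀ (U : Fin n → Fin (m + 2)) (z : Fin n → ℝ) (r p : ℝ),
      (∀ i, 0 ≤ z i ∧ z i ≤ 1) → 0 ≤ r → r ≤ A → 0 ≤ p → p ≤ B →
      |T U z r p| ≤ C ∧ |dT U z r p| ≤ C ∧ (0 < n → |T U z r p| ≤ C * r) ∧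
      (∀ p' : ℝ, 0 ≤ p' → p' ≤ B → |T U z r p - T U z r p'| ≤ C * r * |p - p'|) := by
  intro n
  obtain ⟨C, hC⟩ := hbd n
  -- coefficients and their total mass
  set c : (Fin n → Fin (m + 2)) → (Fin n → Fin (m + 2)) → ℝ :=
    fun U u => (Shuffle.regEnd x (List.ofFn U) (List.ofFn u) : ℝ) with hc
  set S : ℝ := ∑ U : Fin n → Fin (m + 2), ∑ u : Fin n → Fin (m + 2), |c U u| with hS
  have hS0 : 0 ≤ S := Finset.sum_nonneg fun U _ => Finset.sum_nonneg fun u _ => abs_nonneg _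
  have hSU : ∀ U, ∑ u, |c U u| ≤ S := fun U =>
    Finset.single_le_sum (f := fun U => ∑ u, |c U u|) (fun U _ => Finset.sum_nonneg fun u _ => abs_nonneg _)
      (Finset.mem_univ U)
  -- words with a nonzero coefficient do not end in `x`
  have hlast : ∀ U u, c U u ≠ 0 → (List.ofFn u).getLast? ≠ some x := by
    intro U u h
    have h' : Shuffle.regEnd x (List.ofFn U) (List.ofFn u) ≠ 0 := by
      intro h0; apply h; simp only [hc, h0, Rat.cast_zero]
    exact Shuffle.getLast?_ne_of_mem_support_regEnd x _ (Finsupp.mem_support_iff.2 h')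
  set C' := max C 0 with hC'
  have hCC' : C ≤ C' := le_max_left _ _
  have hC'0 : 0 ≤ C' := le_max_right _ _
  -- termwise bounds `|c U u| * (bound with C')`
  have key : ∀ (U u : Fin n → Fin (m + 2)) (z : Fin n → ℝ) (r p : ℝ), (∀ i, 0 ≤ z i ∧ z i ≤ 1) → 0 ≤ r → r ≤ A →
      0 ≤ p → p ≤ B →
      |c U u * q u z r p| ≤ |c U u| * C' ∧ |c U u * dq u z r p| ≤ |c U u| * C' ∧
        (0 < n → |c U u * q u z r p| ≤ |c U u| * (C' * r)) ∧
        (∀ p' : ℝ, 0 ≤ p' → p' ≤ B → |c U u * q u z r p - c U u * q u z r p'| ≤ |c U u| * (C' * r * |p - p'|)) := by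
    intro U u z r p hz hr hrA hp hpB
    by_cases h0 : c U u = 0
    · simp [h0]
    obtain ⟨h1, h2, h3, h4⟩ := hC u z r p (hlast U u h0) hz hr hrA hp hpB
    refine ⟨?_, ?_, fun hn => ?_, fun p' hp' hp'B => ?_⟩
    · rw [abs_mul]; exact mul_le_mul_of_nonneg_left (h1.trans hCC') (abs_nonneg _)
    · rw [abs_mul]; exact mul_le_mul_of_nonneg_left (h2.trans hCC') (abs_nonneg _)
    · rw [abs_mul]
      exact mul_le_mul_of_nonneg_left ((h3 hn).trans (mul_le_mul_of_nonneg_right hCC' hr)) (abs_nonneg _)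
    · rw [← mul_sub, abs_mul]
      refine mul_le_mul_of_nonneg_left ((h4 p' hp' hp'B).trans ?_) (abs_nonneg _)
      exact mul_le_mul_of_nonneg_right (mul_le_mul_of_nonneg_right hCC' hr) (abs_nonneg _)
  refine ⟨S * C', fun U z r p hz hr hrA hp hpB => ?_⟩
  have hT' : T U z r p = ∑ u, c U u * q u z r p := hT U z r p
  have hdT' : dT U z r p = ∑ u, c U u * dq u z r p := hdT U z r p
  refine ⟨?_, ?_, fun hn => ?_, fun p' hp' hp'B => ?_⟩
  · rw [hT']
    refine (Finset.abs_sum_le_sum_abs _ _).trans ((Finset.sum_le_sum fun u _ => (key U u z r p hz hr hrA hp hpB).1).trans ?_)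
    rw [← Finset.sum_mul]
    exact mul_le_mul_of_nonneg_right (hSU U) hC'0
  · rw [hdT']
    refine (Finset.abs_sum_le_sum_abs _ _).trans ((Finset.sum_le_sum fun u _ => (key U u z r p hz hr hrA hp hpB).2.1).trans ?_)
    rw [← Finset.sum_mul]
    exact mul_le_mul_of_nonneg_right (hSU U) hC'0
  · rw [hT']
    refine (Finset.abs_sum_le_sum_abs _ _).trans
      ((Finset.sum_le_sum fun u _ => (key U u z r p hz hr hrA hp hpB).2.2.1 hn).trans ?_)
    rw [← Finset.sum_mul]
    have e1 : S * C' * r = S * (C' * r) := by ring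
    rw [e1]
    exact mul_le_mul_of_nonneg_right (hSU U) (by positivity)
  · rw [hT', hT U z r p', ← Finset.sum_sub_distrib]
    refine (Finset.abs_sum_le_sum_abs _ _).trans
      ((Finset.sum_le_sum fun u _ => (key U u z r p hz hr hrA hp hpB).2.2.2 p' hp' hp'B).trans ?_)
    rw [← Finset.sum_mul]
    have e1 : S * C' * r * |p - p'| = S * (C' * r * |p - p'|) := by ring
    rw [e1]
    exact mul_le_mul_of_nonneg_right (hSU U) (by positivity)

end InstAux

/-- **Hook `cornerEngineInstAux_regEnd_nil`** (registered form of `regEnd_nil_nil`): the end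
regularisation of the empty word is the empty word. [cite: IharaKanekoZagier2006, Cor. 5] -/
theorem cornerEngineInstAux_regEnd_nil : ∀ (m : ℕ) (x : Fin (m + 2)), Shuffle.regEnd x ([] : List (Fin (m + 2))) [] = 1 :=
  fun _ x => regEnd_nil_nil x

end Summit.KontsevichZagierPeriods.FurushoPentagon.PentagonInKZ
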